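import Literature.Analysis.FluidPDE.CheskidovGluedFamily
import Literature.Analysis.FluidPDE.TorusForceBookkeeping
import HarnessLib

/-!
# Cheskidov's time-glued family, II: the Navier–Stokes forces and their limit
(arXiv:2311.04182, §3, (3.11)–(3.13); Bruè–De Lellis 2023, Lemma 5.1)

Topic `Literature/Analysis/FluidPDE` (support file for the proof of
`Literature.Analysis.FluidPDE.cheskidov_total_dissipation_family`). The glued drifts
`v^m = Gluing.drift v m` of `CheskidovGluedFamily` are smooth, divergence free and solve the
Navier–Stokes equations with viscosity `ν_m`, zero pressure and the body force
`g^m = ∂ₜv^m + (v^m·∇)v^m - ν_mΔv^m` (Cheskidov 2023, (3.13); `Torus.nsBodyForce`). Since at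
every time at most one block moves, these forces are read off block by block:

* `Gluing.blockForce v n (t) = ∂ₜ(blockDrift v n)(t) + (blockDrift v n (t)·∇) blockDrift v n (t)`
  `= σ_n'' v_n(σ_n) + (σ_n')²(∂ₛv_n)(σ_n) + (σ_n')² (v_n·∇v_n)(σ_n)` — the Euler force of block `n`;
* `Gluing.nsBodyForce_drift_eq` — for `t ∈ [t_j, t_{j+1})`, `j ≤ m`:
  `nsBodyForce ν (drift v m) t = blockForce v j t - ν σ_j'(t) Δv_j(σ_j(t))`, and `= 0` when no
  block `≤ m` moves (`t < 0` or `t ≥ t_{m+1}`);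
* `Gluing.limForce v (t) = blockForce v (blockIdx t) (t)` for `0 ≤ t < 1`, `0` otherwise —
  Cheskidov's Euler force `g = ∂ₜṽ + (ṽ·∇)ṽ` of (3.11), extended by zero, with
  `g^m - g = -ν_mΔv^m` before `t_{m+1}` and `g^m - g = -g` on `[t_{m+1}, 1)`
  (`Gluing.nsBodyForce_drift_sub_limForce`).

Given uniform bounds on the blocks of the type printed in Cheskidov 2023, Thm. 3.1 (a) and
Bruè–De Lellis 2023, (4.10) — `‖v_n‖_∞ ≤ A₀λ_n⁻¹`, `‖∂ₛv_n‖_∞ ≤ A₁λ_n⁻¹`, `‖Δv_n‖_∞ ≤ A₂λ_n`,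
`‖v_n·∇v_n‖_∞ ≤ A₃λ_n^{-1/2}`, `λ_n = 5^n` (hypothesis structure `Gluing.BlockBounds`) — the file
proves the convergence statement used in §6 of the source ("the resulting force converges in
`L^∞(ℝ; L²)`"; Cheskidov 2023, p. 10 via Bruè–De Lellis Lemma 5.1):
`sup_{t ∈ ℝ} ‖g^m(t) - g(t)‖_{L²} → 0` whenever `ν_m (m+1)(m+2) 5^m → 0`
(`Gluing.tendsto_iSup_eLpNorm_nsBodyForce_sub_limForce`), that `g(t)` is smooth for every `t`
and that `g ∈ C(ℝ; L²)` (`Gluing.continuousInLpOn_limForce`; at the blow-up time `t = 1` because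
`‖g(t)‖_∞ → 0` as `t → 1⁻`).

## References

* A. Cheskidov, arXiv:2311.04182 (2023), §3, (3.11)–(3.13) and the paragraph after (3.13);
  §6, p. 18.
* E. Bruè, C. De Lellis, Comm. Math. Phys. 400 (2023), §5, (5.4), Lemma 5.1.
-/

noncomputable section

open MeasureTheory Set Filter
open _root_.Topology
open scoped InnerProductSpace ContDiff ENNReal NNReal

namespace Literature.Analysis.FluidPDE.Gluing

variable {d : Type*} [Fintype d] [DecidableEq d]

/-! ## Flatness of the block reparametrisations off the middle third -/

section Sigma

variable {n : ℕ} {t : ℝ}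

omit [Fintype d] [DecidableEq d]

/-- `σ_n' = 0` on `(-∞, t_n + τ_n/3]` (closed: `σ_n'` is continuous and vanishes on the open
ray). [folklore] -/
theorem deriv_sigma_eq_zero_of_le (ht : t ≤ tn n + tau n / 3) : deriv (sigma n) t = 0 := by
  have hclosed : IsClosed {s : ℝ | deriv (sigma n) s = 0} :=
    isClosed_eq (deriv_sigma_contDiff n (m := 0)).continuous continuous_const
  have hsub : Iio (tn n + tau n / 3) ⊆ {s : ℝ | deriv (sigma n) s = 0} := fun s hs => deriv_sigma_of_lt hs
  have := (hclosed.closure_subset_iff.2 hsub)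
  rw [closure_Iio] at this
  exact this ht

/-- `σ_n' = 0` on `[t_n + 2τ_n/3, ∞)`. [folklore] -/
theorem deriv_sigma_eq_zero_of_ge (ht : tn n + 2 * tau n / 3 ≤ t) : deriv (sigma n) t = 0 := by
  have hclosed : IsClosed {s : ℝ | deriv (sigma n) s = 0} :=
    isClosed_eq (deriv_sigma_contDiff n (m := 0)).continuous continuous_const
  have hsub : Ioi (tn n + 2 * tau n / 3) ⊆ {s : ℝ | deriv (sigma n) s = 0} := fun s hs => deriv_sigma_of_gt hs
  have := (hclosed.closure_subset_iff.2 hsub)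
  rw [closure_Ioi] at this
  exact this ht

/-- `σ_n'' = 0` on `(-∞, t_n + τ_n/3]`. [folklore] -/
theorem deriv_deriv_sigma_eq_zero_of_le (ht : t ≤ tn n + tau n / 3) : deriv (deriv (sigma n)) t = 0 := by
  have hclosed : IsClosed {s : ℝ | deriv (deriv (sigma n)) s = 0} :=
    isClosed_eq ((deriv_sigma_contDiff n (m := 1)).continuous_deriv le_rfl) continuous_const
  have hsub : Iio (tn n + tau n / 3) ⊆ {s : ℝ | deriv (deriv (sigma n)) s = 0} := by
    intro s hs
    have hev : deriv (sigma n) =ᶠ[𝓝 s] fun _ => (0 : ℝ) := by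
      filter_upwards [Iio_mem_nhds hs] with r hr using deriv_sigma_of_lt hr
    show deriv (deriv (sigma n)) s = 0
    rw [hev.deriv_eq, deriv_const]
  have := (hclosed.closure_subset_iff.2 hsub)
  rw [closure_Iio] at this
  exact this ht

/-- `σ_n'' = 0` on `[t_n + 2τ_n/3, ∞)`. [folklore] -/
theorem deriv_deriv_sigma_eq_zero_of_ge (ht : tn n + 2 * tau n / 3 ≤ t) : deriv (deriv (sigma n)) t = 0 := by
  have hclosed : IsClosed {s : ℝ | deriv (deriv (sigma n)) s = 0} :=
    isClosed_eq ((deriv_sigma_contDiff n (m := 1)).continuous_deriv le_rfl) continuous_const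
  have hsub : Ioi (tn n + 2 * tau n / 3) ⊆ {s : ℝ | deriv (deriv (sigma n)) s = 0} := by
    intro s hs
    have hev : deriv (sigma n) =ᶠ[𝓝 s] fun _ => (0 : ℝ) := by
      filter_upwards [Ioi_mem_nhds hs] with r hr using deriv_sigma_of_gt hr
    show deriv (deriv (sigma n)) s = 0
    rw [hev.deriv_eq, deriv_const]
  have := (hclosed.closure_subset_iff.2 hsub)
  rw [closure_Ioi] at this
  exact this ht

/-- Off the open gluing interval `(t_n, t_{n+1})` both `σ_n'` and `σ_n''` vanish. [folklore] -/
theorem deriv_sigma_eq_zero_of_not_mem (ht : t ∉ Ioo (tn n) (tn (n + 1))) :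
    deriv (sigma n) t = 0 ∧ deriv (deriv (sigma n)) t = 0 := by
  rw [mem_Ioo, not_and_or, not_lt, not_lt] at ht
  rcases ht with ht | ht
  · have h : t ≤ tn n + tau n / 3 := by linarith [tau_pos n]
    exact ⟨deriv_sigma_eq_zero_of_le h, deriv_deriv_sigma_eq_zero_of_le h⟩
  · have h : tn n + 2 * tau n / 3 ≤ t := by rw [tn_succ] at ht; linarith [tau_pos n]
    exact ⟨deriv_sigma_eq_zero_of_ge h, deriv_deriv_sigma_eq_zero_of_ge h⟩

end Sigma

/-! ## The block forces and the Navier–Stokes force of the glued drift -/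

/-- **The Euler force of block `n`**:
`blockForce v n (t) = σ_n''(t) v_n(σ_n(t)) + σ_n'(t)² (∂ₛv_n)(σ_n(t)) + (V·∇)V`,
`V = blockDrift v n (t)`, i.e. `∂ₜV + (V·∇)V` (Cheskidov 2023, (3.11) block by block; Bruè–De
Lellis 2023, (5.4)). [cite: Cheskidov2023, §3 (3.11)] -/
def blockForce (v : ℕ → ℝ → UnitAddTorus d → EuclideanSpace ℝ d) (n : ℕ) (t : ℝ) (x : UnitAddTorus d) :
    EuclideanSpace ℝ d :=
  deriv (deriv (sigma n)) t • v n (sigma n t) x +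
    deriv (sigma n) t • (deriv (sigma n) t • FunctionSpaces.Torus.timeDerivWithin (Icc 0 1) (v n) (sigma n t) x) +
    FunctionSpaces.Torus.convect (blockDrift v n t) (blockDrift v n t) x

section Force

variable {v : ℕ → ℝ → UnitAddTorus d → EuclideanSpace ℝ d} {ρ : ℕ → ℝ → UnitAddTorus d → ℝ}
  {m n : ℕ} {t : ℝ}

omit [DecidableEq d] in
/-- The time derivative of the block drift (two-sided, `univ`). [folklore] -/
theorem timeDerivWithin_blockDrift (h : FunctionSpaces.Torus.IsSmoothSpaceTimeOn (Icc 0 1) (v n)) (t : ℝ) (x : UnitAddTorus d) :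
    FunctionSpaces.Torus.timeDerivWithin univ (blockDrift v n) t x =
      deriv (deriv (sigma n)) t • v n (sigma n t) x +
        deriv (sigma n) t • (deriv (sigma n) t • FunctionSpaces.Torus.timeDerivWithin (Icc 0 1) (v n) (sigma n t) x) := by
  rw [FunctionSpaces.Torus.timeDerivWithin, derivWithin_univ]
  exact (hasDerivAt_blockDrift h t x).deriv

omit [DecidableEq d] in
/-- The block force vanishes off the open gluing interval (there `σ_n' = σ_n'' = 0` and the block
drift is `0`). [folklore] -/
theorem blockForce_eq_zero_of_not_mem (v : ℕ → ℝ → UnitAddTorus d → EuclideanSpace ℝ d)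
    (ht : t ∉ Ioo (tn n) (tn (n + 1))) : blockForce v n t = 0 := by
  funext x
  obtain ⟨h1, h2⟩ := deriv_sigma_eq_zero_of_not_mem ht
  have hc : FunctionSpaces.Torus.convect (0 : UnitAddTorus d → EuclideanSpace ℝ d)
      (0 : UnitAddTorus d → EuclideanSpace ℝ d) x = 0 := Torus.convect_zero_right _ x
  rw [blockForce, blockDrift_eq_zero_of_not_mem v ht, h1, h2, hc]
  simp

omit [DecidableEq d] in
/-- The time derivative of the block drift vanishes off the open gluing interval. [folklore] -/
theorem timeDerivWithin_blockDrift_eq_zero_of_not_mem (h : FunctionSpaces.Torus.IsSmoothSpaceTimeOn (Icc 0 1) (v n))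
    (ht : t ∉ Ioo (tn n) (tn (n + 1))) (x : UnitAddTorus d) :
    FunctionSpaces.Torus.timeDerivWithin univ (blockDrift v n) t x = 0 := by
  obtain ⟨h1, h2⟩ := deriv_sigma_eq_zero_of_not_mem ht
  rw [timeDerivWithin_blockDrift h, h1, h2]
  simp

/-- The time derivative of the glued drift is the sum of those of the blocks. [folklore] -/
theorem timeDerivWithin_drift (hB : Blocks ρ v) (m : ℕ) (t : ℝ) (x : UnitAddTorus d) :
    FunctionSpaces.Torus.timeDerivWithin univ (drift v m) t x =
      ∑ n ∈ Finset.range (m + 1), FunctionSpaces.Torus.timeDerivWithin univ (blockDrift v n) t x := by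
  rw [FunctionSpaces.Torus.timeDerivWithin, derivWithin_univ]
  have h : HasDerivAt (fun s => drift v m s x)
      (∑ n ∈ Finset.range (m + 1), FunctionSpaces.Torus.timeDerivWithin univ (blockDrift v n) t x) t := by
    have := HasDerivAt.fun_sum (u := Finset.range (m + 1)) (x := t)
      (A := fun n s => blockDrift v n s x) fun n _ => hasDerivAt_blockDrift (hB.sol n).smooth_velocity t x
    refine this.congr_deriv (Finset.sum_congr rfl fun n _ => ?_)
    rw [timeDerivWithin_blockDrift (hB.sol n).smooth_velocity]
  exact h.deriv

/-- **The Navier–Stokes force of the glued drift, block by block**: for `t ∈ [t_j, t_{j+1})`,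
`j ≤ m`, `g^m(t) = ∂ₜv^m + (v^m·∇)v^m - νΔv^m = blockForce v j (t) - ν Δ(blockDrift v j (t))`
(Cheskidov 2023, (3.13)). [cite: Cheskidov2023, §3 (3.13)] -/
theorem nsBodyForce_drift_eq (hB : Blocks ρ v) (ν : ℝ) {j : ℕ} (hj : j ≤ m) (ht : t ∈ Ico (tn j) (tn (j + 1)))
    (x : UnitAddTorus d) :
    Torus.nsBodyForce ν (drift v m) t x =
      blockForce v j t x - ν • FunctionSpaces.Torus.laplacian (blockDrift v j t) x := by
  rw [Torus.nsBodyForce, timeDerivWithin_drift hB, drift_eq_blockDrift v hj ht, Finset.sum_eq_single j, blockForce,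
    timeDerivWithin_blockDrift (hB.sol j).smooth_velocity]
  · intro n _ hnj
    refine timeDerivWithin_blockDrift_eq_zero_of_not_mem (hB.sol n).smooth_velocity ?_ x
    rintro ⟨h1, h2⟩
    rcases lt_or_gt_of_ne hnj with h | h
    · have : tn (n + 1) ≤ tn j := tn_mono (Nat.succ_le_of_lt h)
      linarith [ht.1]
    · have : tn (j + 1) ≤ tn n := tn_mono (Nat.succ_le_of_lt h)
      linarith [ht.2]
  · intro h
    exact absurd (Finset.mem_range.2 (Nat.lt_succ_of_le hj)) h

/-- When no block `≤ m` moves (`t < 0` or `t ≥ t_{m+1}`), the Navier–Stokes force of the glued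
drift vanishes. [cite: Cheskidov2023, §3 (3.13)] -/
theorem nsBodyForce_drift_eq_zero (hB : Blocks ρ v) (ν : ℝ) (ht : t < 0 ∨ tn (m + 1) ≤ t) (x : UnitAddTorus d) :
    Torus.nsBodyForce ν (drift v m) t x = 0 := by
  have hnot : ∀ n ∈ Finset.range (m + 1), t ∉ Ioo (tn n) (tn (n + 1)) := by
    rintro n hn ⟨h1, h2⟩
    rcases ht with h | h
    · linarith [tn_nonneg n]
    · have : tn (n + 1) ≤ tn (m + 1) := tn_mono (Nat.succ_le_succ (Nat.lt_succ_iff.1 (Finset.mem_range.1 hn)))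
      linarith
  have hdrift : drift v m t = 0 := by
    rcases ht with h | h
    · exact drift_eq_zero_of_nonpos v h.le
    · exact drift_eq_zero_of_ge v h
  have hc : FunctionSpaces.Torus.convect (0 : UnitAddTorus d → EuclideanSpace ℝ d)
      (0 : UnitAddTorus d → EuclideanSpace ℝ d) x = 0 := Torus.convect_zero_right _ x
  have hl : FunctionSpaces.Torus.laplacian (0 : UnitAddTorus d → EuclideanSpace ℝ d) x = 0 := Torus.laplacian_zero x
  rw [Torus.nsBodyForce, timeDerivWithin_drift hB, hdrift,
    Finset.sum_eq_zero fun n hn => timeDerivWithin_blockDrift_eq_zero_of_not_mem (hB.sol n).smooth_velocity (hnot n hn) x,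
    hc, hl]
  simp

/-! ## The limit force `g` (Cheskidov 2023, (3.11)) -/

/-- **Cheskidov's limit (Euler) force** `g(t) = ∂ₜṽ(t) + (ṽ(t)·∇)ṽ(t)` for `0 ≤ t < 1`
(arXiv:2311.04182, (3.11)), extended by zero to `ℝ`: in the gluing interval containing `t` it is
the Euler force of the moving block. [cite: Cheskidov2023, §3 (3.11)] -/
def limForce (v : ℕ → ℝ → UnitAddTorus d → EuclideanSpace ℝ d) (t : ℝ) (x : UnitAddTorus d) :
    EuclideanSpace ℝ d :=
  if 0 ≤ t ∧ t < 1 then blockForce v (blockIdx t) t x else 0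

/-- For `0 ≤ t < t_{m+1}` the limit force is the inviscid part of `g^m`:
`g(t) = nsBodyForce 0 (drift v m) t`. [cite: Cheskidov2023, §3 (3.11)] -/
theorem limForce_eq_nsBodyForce (hB : Blocks ρ v) (h0 : 0 ≤ t) (ht : t < tn (m + 1)) (x : UnitAddTorus d) :
    limForce v t x = Torus.nsBodyForce 0 (drift v m) t x := by
  have ht1 : t < 1 := ht.trans (tn_lt_one _)
  have hmem : t ∈ Ico (tn (blockIdx t)) (tn (blockIdx t + 1)) := mem_Ico_tn_blockIdx h0 ht1
  have hjm : blockIdx t ≤ m := by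
    by_contra hlt
    push Not at hlt
    have : tn (m + 1) ≤ tn (blockIdx t) := tn_mono (Nat.succ_le_of_lt hlt)
    linarith [hmem.1]
  rw [limForce, if_pos ⟨h0, ht1⟩, nsBodyForce_drift_eq hB 0 hjm hmem, zero_smul, sub_zero]

omit [DecidableEq d] in
/-- For `t < 0` the limit force vanishes, as does every `g^m`. [folklore] -/
theorem limForce_eq_zero_of_neg (v : ℕ → ℝ → UnitAddTorus d → EuclideanSpace ℝ d) (ht : t < 0) :
    limForce v t = 0 := by
  funext x
  rw [limForce, if_neg fun h => absurd h.1 (not_le.2 ht)]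
  rfl

omit [DecidableEq d] in
/-- For `t ≥ 1` the limit force vanishes. [folklore] -/
theorem limForce_eq_zero_of_one_le (v : ℕ → ℝ → UnitAddTorus d → EuclideanSpace ℝ d) (ht : 1 ≤ t) :
    limForce v t = 0 := by
  funext x
  rw [limForce, if_neg fun h => absurd h.2 (not_lt.2 ht)]
  rfl

/-- **`g^m - g` before `t_{m+1}`**: `g^m(t) - g(t) = -ν σ_j'(t) Δv_j(σ_j(t))` in the gluing
interval `[t_j, t_{j+1})`, `j ≤ m` (only the viscous term survives; Cheskidov 2023, p. 10). [cite: Cheskidov2023, §3 (3.13)] -/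
theorem nsBodyForce_drift_sub_limForce (hB : Blocks ρ v) (ν : ℝ) {j : ℕ} (hj : j ≤ m)
    (ht : t ∈ Ico (tn j) (tn (j + 1))) (x : UnitAddTorus d) :
    Torus.nsBodyForce ν (drift v m) t x - limForce v t x =
      -(ν • FunctionSpaces.Torus.laplacian (blockDrift v j t) x) := by
  have h0 : 0 ≤ t := (tn_nonneg j).trans ht.1
  have htm : t < tn (m + 1) := ht.2.trans_le (tn_mono (Nat.succ_le_succ hj))
  rw [limForce_eq_nsBodyForce hB h0 htm, nsBodyForce_drift_eq hB ν hj ht, nsBodyForce_drift_eq hB 0 hj ht]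
  simp

/-- **`g^m - g` on `[t_{m+1}, 1)`**: there `g^m = 0` and `g(t)` is the Euler force of the moving
block `blockIdx t > m`. [cite: Cheskidov2023, §3 (3.13)] -/
theorem nsBodyForce_drift_sub_limForce_of_ge (hB : Blocks ρ v) (ν : ℝ) (htm : tn (m + 1) ≤ t) (ht1 : t < 1)
    (x : UnitAddTorus d) :
    Torus.nsBodyForce ν (drift v m) t x - limForce v t x = -blockForce v (blockIdx t) t x := by
  have h0 : 0 ≤ t := (tn_nonneg _).trans htm
  rw [nsBodyForce_drift_eq_zero hB ν (Or.inr htm), limForce, if_pos ⟨h0, ht1⟩, zero_sub]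

/-- Outside `[0, 1)` both `g^m` and `g` vanish. [folklore] -/
theorem nsBodyForce_drift_sub_limForce_of_not_mem (hB : Blocks ρ v) (ν : ℝ) (ht : t < 0 ∨ 1 ≤ t)
    (x : UnitAddTorus d) : Torus.nsBodyForce ν (drift v m) t x - limForce v t x = 0 := by
  rcases ht with h | h
  · rw [nsBodyForce_drift_eq_zero hB ν (Or.inl h), limForce_eq_zero_of_neg v h]
    simp
  · rw [nsBodyForce_drift_eq_zero hB ν (Or.inr ((tn_lt_one _).le.trans h)), limForce_eq_zero_of_one_le v h]
    simp

end Force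

/-! ## Uniform bounds on the blocks and the resulting estimates -/

/-- **Uniform bounds on the building blocks** (the sup-norm content of Cheskidov 2023,
Thm. 3.1 (a) — `‖∂ₜ^k v_n‖_{L^∞(0,1;C^α)} ≤ C(α,k) λ_n^{α-1}` with `(α,k) ∈ {(0,0),(0,1),(2,0)}` —
and of Bruè–De Lellis 2023, (4.10) with `α = 1/2`, `k = 0`: `‖v_n·∇v_n‖_∞ ≤ C λ_n^{-1/2}`;
`λ_n = 5^n`), with one common constant `A`. [cite: Cheskidov2023, Thm. 3.1 (a)] -/
structure BlockBounds (v : ℕ → ℝ → UnitAddTorus d → EuclideanSpace ℝ d) (A : ℝ) : Prop where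
  /-- The constant is nonnegative. -/
  nonneg : 0 ≤ A
  /-- `‖v_n(s)‖_∞ ≤ A λ_n⁻¹`. -/
  sup_le : ∀ n, ∀ s ∈ Icc (0 : ℝ) 1, ∀ x, ‖v n s x‖ ≤ A / 5 ^ n
  /-- `‖∂ₛv_n(s)‖_∞ ≤ A λ_n⁻¹`. -/
  timeDeriv_le : ∀ n, ∀ s ∈ Icc (0 : ℝ) 1, ∀ x,
    ‖FunctionSpaces.Torus.timeDerivWithin (Icc 0 1) (v n) s x‖ ≤ A / 5 ^ n
  /-- `‖Δv_n(s)‖_∞ ≤ A λ_n`. -/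
  laplacian_le : ∀ n, ∀ s ∈ Icc (0 : ℝ) 1, ∀ x, ‖FunctionSpaces.Torus.laplacian (v n s) x‖ ≤ A * 5 ^ n
  /-- `‖(v_n·∇)v_n(s)‖_∞ ≤ A λ_n^{-1/2}`. -/
  convect_le : ∀ n, ∀ s ∈ Icc (0 : ℝ) 1, ∀ x,
    ‖FunctionSpaces.Torus.convect (v n s) (v n s) x‖ ≤ A / Real.sqrt 5 ^ n

section Bounds

variable {v : ℕ → ℝ → UnitAddTorus d → EuclideanSpace ℝ d} {ρ : ℕ → ℝ → UnitAddTorus d → ℝ}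
  {A : ℝ} {m n : ℕ} {t : ℝ}

omit [Fintype d] [DecidableEq d] in
/-- `1/τ_n = (n+1)(n+2)`. [folklore] -/
theorem one_div_tau (n : ℕ) : 1 / tau n = (n + 1) * (n + 2) := by
  rw [tau, one_div_one_div]

omit [Fintype d] [DecidableEq d] in
/-- `(n+1)(n+2) ≤ 2 · 5^n`. [folklore] -/
theorem succ_mul_succ_le_two_mul_pow (n : ℕ) : ((n : ℝ) + 1) * (n + 2) ≤ 2 * 5 ^ n := by
  induction n with
  | zero => norm_num
  | succ k ih =>
    push_cast
    have h5 : (5 : ℝ) ^ (k + 1) = 5 * 5 ^ k := by ring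
    nlinarith [ih, pow_pos (by norm_num : (0 : ℝ) < 5) k]

omit [Fintype d] [DecidableEq d] in
/-- `(n+1)(n+2) 5^n` is monotone in `n`. [folklore] -/
theorem succ_mul_succ_mul_pow_mono : Monotone fun n : ℕ => ((n : ℝ) + 1) * (n + 2) * 5 ^ n := by
  refine monotone_nat_of_le_succ fun n => ?_
  push_cast
  rw [pow_succ]
  have hP : 0 ≤ (5 : ℝ) ^ n * (((n : ℝ) + 2) * (4 * n + 14)) := by positivity
  nlinarith [hP]

omit [DecidableEq d] in
/-- The convective derivative is homogeneous in both slots: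
`((c u)·∇)(c u) = c² (u·∇)u` for a `C¹` field. [folklore] -/
theorem convect_const_smul_const_smul
    {u : UnitAddTorus d → EuclideanSpace ℝ d} (hu : FunctionSpaces.Torus.IsContDiff 1 u) (c : ℝ)
    (x : UnitAddTorus d) :
    FunctionSpaces.Torus.convect (c • u) (c • u) x = (c * c) • FunctionSpaces.Torus.convect u u x := by
  rw [FunctionSpaces.Torus.convect, FunctionSpaces.Torus.convect, FunctionSpaces.Torus.fderiv_const_smul hu]
  simp [smul_smul]

omit [DecidableEq d] in
/-- **Pointwise bound on the block drift**: `‖blockDrift v n (t,x)‖ ≤ (B/τ_n) A λ_n⁻¹` where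
`|σ_n'| ≤ B/τ_n` (Cheskidov 2023, (6.5); Bruè–De Lellis 2023, (5.1)). [cite: Cheskidov2023, §6 (6.5)] -/
theorem norm_blockDrift_le (hA : BlockBounds v A) {B : ℝ} (hB : ∀ n t, |deriv (sigma n) t| ≤ B / tau n)
    (n : ℕ) (t : ℝ) (x : UnitAddTorus d) :
    ‖blockDrift v n t x‖ ≤ B / tau n * (A / 5 ^ n) := by
  rw [blockDrift, norm_smul, Real.norm_eq_abs]
  exact mul_le_mul (hB n t) (hA.sup_le n _ (sigma_mem_Icc n t) x) (norm_nonneg _)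
    ((abs_nonneg _).trans (hB n t))

omit [DecidableEq d] in
/-- **Pointwise bound on the Laplacian of the block drift**:
`‖Δ blockDrift v n (t,x)‖ ≤ (B/τ_n) A λ_n`. [cite: Cheskidov2023, Thm. 3.1 (a)] -/
theorem norm_laplacian_blockDrift_le (hsm : FunctionSpaces.Torus.IsSmoothSpaceTimeOn (Icc 0 1) (v n))
    (hA : BlockBounds v A) {B : ℝ} (hB : ∀ n t, |deriv (sigma n) t| ≤ B / tau n) (t : ℝ) (x : UnitAddTorus d) :
    ‖FunctionSpaces.Torus.laplacian (blockDrift v n t) x‖ ≤ B / tau n * (A * 5 ^ n) := by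
  have heq : blockDrift v n t = deriv (sigma n) t • v n (sigma n t) := rfl
  rw [heq, Torus.laplacian_const_smul' (hsm.isSmooth_slice (sigma_mem_Icc n t)), norm_smul, Real.norm_eq_abs]
  exact mul_le_mul (hB n t) (hA.laplacian_le n _ (sigma_mem_Icc n t) x) (norm_nonneg _)
    ((abs_nonneg _).trans (hB n t))

omit [DecidableEq d] in
/-- **Pointwise bound on the block force**:
`‖blockForce v n (t,x)‖ ≤ (B₂/τ_n²) A λ_n⁻¹ + (B/τ_n)² A λ_n⁻¹ + (B/τ_n)² A λ_n^{-1/2}` where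
`|σ_n'| ≤ B/τ_n`, `|σ_n''| ≤ B₂/τ_n²` (the three terms of `∂ₜV + (V·∇)V`; Cheskidov 2023, p. 10;
Bruè–De Lellis 2023, proof of Lemma 5.1). [cite: Cheskidov2023, §3 (3.11)] -/
theorem norm_blockForce_le (hsm : FunctionSpaces.Torus.IsSmoothSpaceTimeOn (Icc 0 1) (v n)) (hA : BlockBounds v A)
    {B B₂ : ℝ} (hB : ∀ n t, |deriv (sigma n) t| ≤ B / tau n) (hB₂ : ∀ n t, |deriv (deriv (sigma n)) t| ≤ B₂ / tau n ^ 2)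
    (t : ℝ) (x : UnitAddTorus d) :
    ‖blockForce v n t x‖ ≤ B₂ / tau n ^ 2 * (A / 5 ^ n) + (B / tau n) ^ 2 * (A / 5 ^ n) +
      (B / tau n) ^ 2 * (A / Real.sqrt 5 ^ n) := by
  have hs := sigma_mem_Icc n t
  have hv1 : FunctionSpaces.Torus.IsContDiff 1 (v n (sigma n t)) := (hsm.isSmooth_slice hs).isContDiff (by simp)
  have hBn : 0 ≤ B / tau n := (abs_nonneg _).trans (hB n t)
  have hσ2 : deriv (sigma n) t * deriv (sigma n) t ≤ (B / tau n) ^ 2 := by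
    have h1 := hB n t
    rw [abs_le] at h1
    nlinarith
  have hσ2' : |deriv (sigma n) t * deriv (sigma n) t| ≤ (B / tau n) ^ 2 := by
    rw [abs_le]; constructor <;> nlinarith [mul_self_nonneg (deriv (sigma n) t)]
  rw [blockForce]
  refine (norm_add₃_le).trans (add_le_add_three ?_ ?_ ?_)
  · rw [norm_smul, Real.norm_eq_abs]
    exact mul_le_mul (hB₂ n t) (hA.sup_le n _ hs x) (norm_nonneg _) ((abs_nonneg _).trans (hB₂ n t))
  · rw [smul_smul, norm_smul, Real.norm_eq_abs]
    exact mul_le_mul hσ2' (hA.timeDeriv_le n _ hs x) (norm_nonneg _) (sq_nonneg _)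
  · have heq : blockDrift v n t = deriv (sigma n) t • v n (sigma n t) := rfl
    rw [heq, convect_const_smul_const_smul hv1, norm_smul, Real.norm_eq_abs]
    exact mul_le_mul hσ2' (hA.convect_le n _ hs x) (norm_nonneg _) (sq_nonneg _)

/-- **The block forces tend to zero uniformly**: with `forceBound A B B₂ n`, the right-hand
side of `norm_blockForce_le`, `forceBound A B B₂ n → 0` (polynomial times `5^{-n/2}`; this is
why `g ∈ C(ℝ; L²)` across the blow-up time and why `g^m → g` uniformly; Cheskidov 2023, p. 10,
Bruè–De Lellis 2023, Lemma 5.1). [cite: Cheskidov2023, §3 (3.11)] -/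
def forceBound (A B B₂ : ℝ) (n : ℕ) : ℝ :=
  B₂ / tau n ^ 2 * (A / 5 ^ n) + (B / tau n) ^ 2 * (A / 5 ^ n) + (B / tau n) ^ 2 * (A / Real.sqrt 5 ^ n)

omit [Fintype d] [DecidableEq d] in
/-- `n^k / r^n → 0` for `r > 1`, in the shifted form `(n+2)^4 / r^n → 0`. [folklore] -/
theorem tendsto_succ_succ_pow_four_div_pow {r : ℝ} (hr : 1 < r) :
    Tendsto (fun n : ℕ => ((n : ℝ) + 2) ^ 4 / r ^ n) atTop (𝓝 0) := by
  have h := (tendsto_pow_const_div_const_pow_of_one_lt 4 hr).comp (tendsto_add_atTop_nat 2)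
  have hr0 : 0 < r := zero_lt_one.trans hr
  have heq : (fun n : ℕ => ((n : ℝ) + 2) ^ 4 / r ^ n) = fun n => r ^ 2 * (((n + 2 : ℕ) : ℝ) ^ 4 / r ^ (n + 2)) := by
    funext n
    push_cast
    rw [pow_add]
    field_simp
  rw [heq]
  simpa using h.const_mul (r ^ 2)

omit [Fintype d] [DecidableEq d] in
/-- `((n+1)(n+2))² / r^n → 0` for `r > 1` (squeezed by `(n+2)^4 / r^n`). [folklore] -/
theorem tendsto_sq_succ_mul_succ_div_pow {r : ℝ} (hr : 1 < r) :
    Tendsto (fun n : ℕ => (((n : ℝ) + 1) * (n + 2)) ^ 2 / r ^ n) atTop (𝓝 0) := by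
  have hr0 : 0 < r := zero_lt_one.trans hr
  refine squeeze_zero (fun n => by positivity) (fun n => ?_) (tendsto_succ_succ_pow_four_div_pow hr)
  refine div_le_div_of_nonneg_right ?_ (pow_pos hr0 n).le
  have h : ((n : ℝ) + 1) * (n + 2) ≤ (n + 2) * (n + 2) := by nlinarith
  calc (((n : ℝ) + 1) * (n + 2)) ^ 2 ≤ ((n + 2) * ((n : ℝ) + 2)) ^ 2 := pow_le_pow_left₀ (by positivity) h 2
    _ = ((n : ℝ) + 2) ^ 4 := by ring

omit [Fintype d] [DecidableEq d] in
/-- The force bound in closed form: `τ_n⁻¹ = (n+1)(n+2)`. [folklore] -/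
theorem forceBound_eq (A B B₂ : ℝ) (n : ℕ) :
    forceBound A B B₂ n = B₂ * A * ((((n : ℝ) + 1) * (n + 2)) ^ 2 / 5 ^ n) +
      B ^ 2 * A * ((((n : ℝ) + 1) * (n + 2)) ^ 2 / 5 ^ n) +
      B ^ 2 * A * ((((n : ℝ) + 1) * (n + 2)) ^ 2 / Real.sqrt 5 ^ n) := by
  have h1 : (tau n)⁻¹ = ((n : ℝ) + 1) * (n + 2) := by rw [tau, one_div, inv_inv]
  rw [forceBound, div_eq_mul_inv B₂, div_eq_mul_inv B, ← inv_pow, h1]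
  ring

omit [Fintype d] [DecidableEq d] in
/-- The force bound tends to zero. [cite: Cheskidov2023, §3 (3.11)] -/
theorem tendsto_forceBound (A B B₂ : ℝ) : Tendsto (forceBound A B B₂) atTop (𝓝 0) := by
  have h5 : (1 : ℝ) < Real.sqrt 5 := by
    rw [show (1 : ℝ) = Real.sqrt 1 from Real.sqrt_one.symm]
    exact Real.sqrt_lt_sqrt zero_le_one (by norm_num)
  have hA := tendsto_sq_succ_mul_succ_div_pow (show (1 : ℝ) < 5 by norm_num)
  have hC := tendsto_sq_succ_mul_succ_div_pow h5
  have h := ((hA.const_mul (B₂ * A)).add (hA.const_mul (B ^ 2 * A))).add (hC.const_mul (B ^ 2 * A))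
  simp only [mul_zero, add_zero] at h
  refine h.congr fun n => ?_
  rw [forceBound_eq]

omit [DecidableEq d] in
/-- **Uniform `L²` bound on the glued drifts** (Cheskidov 2023, (6.5):
`sup_m ‖v^m‖_{L^∞(ℝ;L²)} < ∞`, indeed `‖v^m(t,x)‖ ≤ 2BA` pointwise since at most one block moves
and `(n+1)(n+2) ≤ 2·5^n`). [cite: Cheskidov2023, §6 (6.5)] -/
theorem norm_drift_le (hA : BlockBounds v A) {B : ℝ} (hB0 : 0 ≤ B)
    (hB : ∀ n t, |deriv (sigma n) t| ≤ B / tau n) (m : ℕ) (t : ℝ) (x : UnitAddTorus d) :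
    ‖drift v m t x‖ ≤ 2 * B * A := by
  have hblock : ∀ n, ‖blockDrift v n t x‖ ≤ 2 * B * A := fun n => by
    refine (norm_blockDrift_le hA hB n t x).trans ?_
    rw [div_eq_mul_one_div B, one_div_tau]
    have h5 : (0 : ℝ) < 5 ^ n := pow_pos (by norm_num) n
    have h1 : ((n : ℝ) + 1) * (n + 2) * (A / 5 ^ n) ≤ 2 * A := by
      rw [mul_div_assoc', div_le_iff₀ h5]
      nlinarith [succ_mul_succ_le_two_mul_pow n, hA.nonneg]
    calc B * (((n : ℝ) + 1) * (n + 2)) * (A / 5 ^ n) = B * (((n : ℝ) + 1) * (n + 2) * (A / 5 ^ n)) := by ring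
      _ ≤ B * (2 * A) := mul_le_mul_of_nonneg_left h1 hB0
      _ = 2 * B * A := by ring
  by_cases hpos : 0 ≤ t ∧ t < tn (m + 1)
  · obtain ⟨h0, htm⟩ := hpos
    have ht1 : t < 1 := htm.trans (tn_lt_one _)
    have hmem := mem_Ico_tn_blockIdx h0 ht1
    have hjm : blockIdx t ≤ m := by
      by_contra hlt
      push Not at hlt
      have : tn (m + 1) ≤ tn (blockIdx t) := tn_mono (Nat.succ_le_of_lt hlt)
      linarith [hmem.1]
    rw [drift_eq_blockDrift v hjm hmem]
    exact hblock _
  · have h0 : drift v m t = 0 := by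
      rw [not_and_or, not_le, not_lt] at hpos
      rcases hpos with h | h
      · exact drift_eq_zero_of_nonpos v h.le
      · exact drift_eq_zero_of_ge v h
    rw [h0]
    simp only [Pi.zero_apply, norm_zero]
    exact mul_nonneg (mul_nonneg zero_le_two hB0) hA.nonneg

/-- **Pointwise bound on `g^m - g`**: for `ν ≥ 0` and every `t`, `x`,
`‖g^m(t,x) - g(t,x)‖ ≤ max (ν B A (m+1)(m+2) 5^m) (sup_{j > m} forceBound j)` — stated as: it is
`≤ ν B A (m+1)(m+2) 5^m` if the moving block has index `≤ m`, and `≤ forceBound A B B₂ j` for the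
moving block `j > m` otherwise (Cheskidov 2023, p. 10: `g^m → g`). [cite: Cheskidov2023, §3 (3.13)] -/
theorem norm_nsBodyForce_drift_sub_limForce_le (hBl : Blocks ρ v) (hA : BlockBounds v A) {ν : ℝ} (hν : 0 ≤ ν)
    {B B₂ : ℝ} (hB : ∀ n t, |deriv (sigma n) t| ≤ B / tau n)
    (hB₂ : ∀ n t, |deriv (deriv (sigma n)) t| ≤ B₂ / tau n ^ 2) {δ : ℝ}
    (h1 : ν * (B * A * (((m : ℝ) + 1) * (m + 2) * 5 ^ m)) ≤ δ) (h2 : ∀ j, m < j → forceBound A B B₂ j ≤ δ)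
    (hδ : 0 ≤ δ) (t : ℝ) (x : UnitAddTorus d) :
    ‖Torus.nsBodyForce ν (drift v m) t x - limForce v t x‖ ≤ δ := by
  by_cases hrange : 0 ≤ t ∧ t < 1
  · obtain ⟨h0, ht1⟩ := hrange
    set j := blockIdx t with hj
    have hmem : t ∈ Ico (tn j) (tn (j + 1)) := mem_Ico_tn_blockIdx h0 ht1
    by_cases hjm : j ≤ m
    · rw [nsBodyForce_drift_sub_limForce hBl ν hjm hmem, norm_neg, norm_smul, Real.norm_eq_abs, abs_of_nonneg hν]
      refine le_trans ?_ h1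
      refine mul_le_mul_of_nonneg_left ?_ hν
      refine (norm_laplacian_blockDrift_le (hBl.sol j).smooth_velocity hA hB t x).trans ?_
      rw [div_eq_mul_one_div B, one_div_tau]
      have hmono := succ_mul_succ_mul_pow_mono hjm
      dsimp only at hmono
      have hB0 : 0 ≤ B := by
        have := (abs_nonneg _).trans (hB 0 0)
        rwa [le_div_iff₀ (tau_pos 0), zero_mul] at this
      nlinarith [hA.nonneg, mul_nonneg hB0 hA.nonneg]
    · push Not at hjm
      have htm : tn (m + 1) ≤ t := (tn_mono (Nat.succ_le_of_lt hjm)).trans hmem.1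
      rw [nsBodyForce_drift_sub_limForce_of_ge hBl ν htm ht1, norm_neg]
      exact (norm_blockForce_le (hBl.sol j).smooth_velocity hA hB hB₂ t x).trans (h2 j hjm)
  · rw [not_and_or, not_le, not_lt] at hrange
    rw [nsBodyForce_drift_sub_limForce_of_not_mem hBl ν hrange, norm_zero]
    exact hδ

/-- **The Navier–Stokes forces converge to the limit force uniformly in time with values in
`L²`** (Cheskidov 2023, §6: "the resulting force converges in `L^∞(ℝ; L²)`"; p. 10 via
Bruè–De Lellis 2023, Lemma 5.1): if `ν_m ≥ 0` and `ν_m (m+1)(m+2) 5^m → 0`, then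
`sup_{t ∈ ℝ} ‖nsBodyForce ν_m (drift v m) t - limForce v t‖_{L²} → 0`. [cite: Cheskidov2023, §6 p. 18] -/
theorem tendsto_iSup_eLpNorm_nsBodyForce_sub_limForce (hBl : Blocks ρ v) (hA : BlockBounds v A)
    {ν : ℕ → ℝ} (hν0 : ∀ m, 0 ≤ ν m)
    (hν : Tendsto (fun m : ℕ => ν m * (((m : ℝ) + 1) * (m + 2) * 5 ^ m)) atTop (𝓝 0)) :
    Tendsto (fun m => ⨆ t : ℝ, eLpNorm (Torus.nsBodyForce (ν m) (drift v m) t - limForce v t) 2 volume)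
      atTop (𝓝 0) := by
  obtain ⟨B, hB0, hB⟩ := exists_forall_abs_deriv_sigma_le
  obtain ⟨B₂, hB₂0, hB₂⟩ := exists_forall_abs_deriv_deriv_sigma_le
  rw [ENNReal.tendsto_atTop_zero]
  intro ε hε
  rcases eq_or_ne ε ⊤ with hε' | hε'
  · exact ⟨0, fun m _ => hε'.symm ▸ le_top⟩
  have hδ : 0 < ε.toReal := ENNReal.toReal_pos hε.ne' hε'
  -- the viscous part
  have hν' : Tendsto (fun m : ℕ => ν m * (B * A * (((m : ℝ) + 1) * (m + 2) * 5 ^ m))) atTop (𝓝 0) := by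
    have := hν.const_mul (B * A)
    rw [mul_zero] at this
    refine this.congr fun m => ?_
    ring
  obtain ⟨M₁, hM₁⟩ := (hν'.eventually (Iic_mem_nhds hδ)).exists_forall_of_atTop
  -- the inviscid part of the later blocks
  obtain ⟨M₂, hM₂⟩ := ((tendsto_forceBound A B B₂).eventually (Iic_mem_nhds hδ)).exists_forall_of_atTop
  refine ⟨max M₁ M₂, fun m hm => ?_⟩
  refine iSup_le fun t => ?_
  have hpt := norm_nsBodyForce_drift_sub_limForce_le hBl hA (hν0 m) hB hB₂ (hM₁ m (le_of_max_le_left hm))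
    (fun j hj => hM₂ j ((le_of_max_le_right hm).trans hj.le)) hδ.le t
  calc eLpNorm (Torus.nsBodyForce (ν m) (drift v m) t - limForce v t) 2 volume
      ≤ ENNReal.ofReal ε.toReal := Torus.eLpNorm_le_of_forall_norm_le (fun x => hpt x) 2
    _ = ε := ENNReal.ofReal_toReal hε'

/-! ## Smoothness and `L²`-continuity of the limit force (Cheskidov 2023, §6: `g ∈ C(ℝ; L²)`) -/

omit [DecidableEq d] in
/-- The block force has smooth time slices. [folklore] -/
theorem isSmooth_blockForce (hsm : FunctionSpaces.Torus.IsSmoothSpaceTimeOn (Icc 0 1) (v n)) (t : ℝ) :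
    FunctionSpaces.Torus.IsSmooth (blockForce v n t) := by
  have hs := sigma_mem_Icc n t
  have hv : FunctionSpaces.Torus.IsSmooth (v n (sigma n t)) := hsm.isSmooth_slice hs
  have hd : FunctionSpaces.Torus.IsSmooth (FunctionSpaces.Torus.timeDerivWithin (Icc 0 1) (v n) (sigma n t)) :=
    hsm.isSmooth_timeDerivWithin (uniqueDiffOn_Icc zero_lt_one) hs
  have hV : FunctionSpaces.Torus.IsSmooth (blockDrift v n t) := isSmooth_blockDrift hsm t
  exact ((hv.smul _).add ((hd.smul _).smul _)).add (hV.convect hV)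

/-- **The limit force is smooth in `x` at every time.** [cite: Cheskidov2023, §3 (3.11)] -/
theorem isSmooth_limForce (hBl : Blocks ρ v) (t : ℝ) : FunctionSpaces.Torus.IsSmooth (limForce v t) := by
  by_cases h : 0 ≤ t ∧ t < 1
  · have : limForce v t = blockForce v (blockIdx t) t := by
      funext x; rw [limForce, if_pos h]
    rw [this]
    exact isSmooth_blockForce (hBl.sol _).smooth_velocity t
  · have : limForce v t = fun _ => 0 := by
      funext x; rw [limForce, if_neg h]
    rw [this]
    exact FunctionSpaces.Torus.isSmooth_const _

/-- The inviscid Navier–Stokes force of the glued drift is a smooth space–time field on `ℝ × T^d`. [folklore] -/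
theorem isSmoothSpaceTimeOn_nsBodyForce_drift (hBl : Blocks ρ v) (ν : ℝ) (m : ℕ) :
    FunctionSpaces.Torus.IsSmoothSpaceTimeOn univ (Torus.nsBodyForce ν (drift v m)) := by
  have hd := isSmoothSpaceTimeOn_drift hBl m
  have hU : UniqueDiffOn ℝ (univ : Set ℝ) := uniqueDiffOn_univ
  have h := ((hd.timeDerivWithin hU).add (hd.convect hd hU)).sub ((hd.laplacian hU).const_smul ν)
  exact h

/-- **The limit force near a time `t₀ < 1` is one of the smooth forces**: on `(-∞, t_{m+1})`,
`g = nsBodyForce 0 (drift v m)`. [cite: Cheskidov2023, §3 (3.11)] -/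
theorem limForce_eq_nsBodyForce_of_lt (hBl : Blocks ρ v) (ht : t < tn (m + 1)) :
    limForce v t = Torus.nsBodyForce 0 (drift v m) t := by
  funext x
  by_cases h0 : 0 ≤ t
  · exact limForce_eq_nsBodyForce hBl h0 ht x
  · push Not at h0
    rw [limForce_eq_zero_of_neg v h0, nsBodyForce_drift_eq_zero hBl 0 (Or.inl h0)]
    rfl

/-- **Pointwise decay of the limit force towards the blow-up time**: for `t ∈ [t_J, 1)` the
moving block has index `≥ J`, so `‖g(t,x)‖ ≤ forceBound (blockIdx t)` with `blockIdx t ≥ J`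
(this is `‖g(t)‖_∞ → 0` as `t → 1⁻`; Cheskidov 2023, §6). [cite: Cheskidov2023, §6 p. 18] -/
theorem norm_limForce_le (hBl : Blocks ρ v) (hA : BlockBounds v A) {B B₂ : ℝ}
    (hB : ∀ n t, |deriv (sigma n) t| ≤ B / tau n) (hB₂ : ∀ n t, |deriv (deriv (sigma n)) t| ≤ B₂ / tau n ^ 2)
    (h0 : 0 ≤ t) (ht1 : t < 1) (x : UnitAddTorus d) :
    ‖limForce v t x‖ ≤ forceBound A B B₂ (blockIdx t) := by
  rw [limForce, if_pos ⟨h0, ht1⟩]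
  exact norm_blockForce_le (hBl.sol _).smooth_velocity hA hB hB₂ t x

/-- **The limit force is continuous in time with values in `L²` on all of `ℝ`** (Cheskidov 2023,
§6: `g^m → g` in `L^∞(ℝ; L²)` with `g ∈ C(ℝ; L²)`; away from `t = 1` it is locally a smooth
field, at `t = 1` it tends to `0 = g(1)` because the block forces decay). [cite: Cheskidov2023, §6 p. 18] -/
theorem continuousInLpOn_limForce (hBl : Blocks ρ v) (hA : BlockBounds v A) :
    Torus.ContinuousInLpOn univ 2 (limForce v) := by
  refine ⟨fun t _ => (isSmooth_limForce hBl t).memLp 2, fun t₀ _ => ?_⟩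
  rw [nhdsWithin_univ]
  rcases lt_trichotomy t₀ 1 with ht₀ | rfl | ht₀
  · -- locally one of the smooth forces
    obtain ⟨m, hm⟩ : ∃ m : ℕ, t₀ < tn (m + 1) :=
      ((tendsto_tn.comp (tendsto_add_atTop_nat 1)).eventually (Ioi_mem_nhds ht₀)).exists
    have hcont := (isSmoothSpaceTimeOn_nsBodyForce_drift hBl 0 m).continuousInLpOn 2
    have h := hcont.2 t₀ (mem_univ _)
    rw [nhdsWithin_univ] at h
    refine h.congr' ?_
    filter_upwards [Iio_mem_nhds hm] with s hs
    rw [limForce_eq_nsBodyForce_of_lt hBl hs, limForce_eq_nsBodyForce_of_lt hBl hm]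
  · -- the blow-up time: `‖g(s)‖_∞ → 0` as `s → 1⁻`, `g = 0` for `s ≥ 1`
    obtain ⟨B, hB0, hB⟩ := exists_forall_abs_deriv_sigma_le
    obtain ⟨B₂, hB₂0, hB₂⟩ := exists_forall_abs_deriv_deriv_sigma_le
    rw [ENNReal.tendsto_nhds_zero]
    intro ε hε
    rcases eq_or_ne ε ⊤ with hε' | hε'
    · exact Eventually.of_forall fun t => hε'.symm ▸ le_top
    have hδ : 0 < ε.toReal := ENNReal.toReal_pos hε.ne' hε'
    obtain ⟨J, hJ⟩ := ((tendsto_forceBound A B B₂).eventually (Iic_mem_nhds hδ)).exists_forall_of_atTop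
    filter_upwards [Ioi_mem_nhds (tn_lt_one J)] with s hs
    rw [limForce_eq_zero_of_one_le v le_rfl, sub_zero]
    have hpt : ∀ x, ‖limForce v s x‖ ≤ ε.toReal := by
      intro x
      by_cases hs1 : s < 1
      · have h0 : 0 ≤ s := (tn_nonneg J).trans hs.le
        exact (norm_limForce_le hBl hA hB hB₂ h0 hs1 x).trans (hJ _ (le_blockIdx_of_tn_le hs.le hs1))
      · rw [limForce_eq_zero_of_one_le v (not_lt.1 hs1)]
        simp [hδ.le]
    calc eLpNorm (limForce v s) 2 volume ≤ ENNReal.ofReal ε.toReal := Torus.eLpNorm_le_of_forall_norm_le hpt 2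
      _ = ε := ENNReal.ofReal_toReal hε'
  · -- after the blow-up time everything vanishes
    refine tendsto_const_nhds.congr' ?_
    filter_upwards [Ioi_mem_nhds ht₀] with s hs
    rw [limForce_eq_zero_of_one_le v hs.le, limForce_eq_zero_of_one_le v ht₀.le, sub_zero, eLpNorm_zero]

end Bounds

end Literature.Analysis.FluidPDE.Gluing

end
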